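import Summits.Ventures.PercRepro.S1CoreCapSpecSpreadSixMain

/-!
# PercRepro — THE SPREAD `s₄` CAPS AT EVERY POINT COUNT: `s₄ ≤ ⌊n·24/(n − 4)⌋` AT NULLITY `6`, `⌊n·33/(n − 4)⌋` AT NULLITY `7`,
AND THE `(13, 6)` INSTANCE `s₄ ≤ 30` (p1, gen 33)

`proofs/P1-S2-CORANK6.md` §4j. The spread chains `s₄ ≤ 24` at nullity `5` (`ncard_fourCircuits_le_twenty_four_spread`) and `s₄ ≤ 33` at
nullity `6` (`ncard_fourCircuits_le_thirty_three_spread`) feed the averaging recursion `ncard_fourCircuits_sub_div_le_of_nonColoops_spread`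
with the point count as the number of non-coloops; the `(14, 6)` / `(14, 7)` instances (`…le_thirty_spread_twenty`, `…le_forty_spread_twenty_one`)
fixed `n = 20 / 21`. Here the step is stated for EVERY `n > 4` (`s − ⌊4s/n⌋ ≤ B ⟹ s ≤ ⌊n·B/(n − 4)⌋`, `le_mul_div_of_sub_div_le`), so the
rows `p = 12, 13, 15, …` of the S2 lane take their spread `s₄` caps by one `norm_num`: at nullity `6` on `n` points `s₄ ≤ n·24/(n − 4)`
(`18 ↦ 30`, `19 ↦ 30`, `20 ↦ 30`, `21 ↦ 29`), at nullity `7` `s₄ ≤ n·33/(n − 4)` (`19 ↦ 41`, `20 ↦ 41`, `21 ↦ 40`, `22 ↦ 40`).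
The instance of record for the live rung: **`s₄ ≤ 30` on the `(13, 6)` coloop-free spread core (`19` points)** — against the global
cap `35` of `caps_thirteen_six_cf` (SUBCLAIM-S2 §(ad)).
* `ncard_fourCircuits_le_mul_div_spread_six`, `ncard_fourCircuits_le_mul_div_spread_seven`,
  **`ncard_fourCircuits_le_thirty_spread_nineteen`**, `ncard_fourCircuits_le_thirty_spread_eighteen`,
  `ncard_fourCircuits_le_forty_one_spread_twenty`.
Axioms: standard.
-/

open scoped Matroid

namespace PercRepro

namespace S1

open Set

variable {α : Type}

/-- **The spread `s₄` cap at nullity `6` on `n` points, coloop-free**: `s₄ ≤ ⌊n·24/(n − 4)⌋` (`s − ⌊4s/n⌋ ≤ 24`). -/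
theorem ncard_fourCircuits_le_mul_div_spread_six (M : Matroid α) [M.Finite]
    (hfree : ∀ e ∈ M.E, ∃ A ⊆ M.E \ {e}, e ∉ M.closure A ∧ e ∉ M.closure ((M.E \ {e}) \ A))
    (hns : ¬ ∃ W ⊆ M.E, W.ncard ≤ 9 ∧ W.encard = M.eRk W + 4) (hd : M.E.encard = M.eRank + 6)
    {n : ℕ} (hn : M.E.ncard = n) (hn4 : 4 < n) (hK : ∀ e, ¬ M.IsColoop e) :
    {C : Set α | M.IsCircuit C ∧ C.ncard = 4}.ncard ≤ n * 24 / (n - 4) := by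
  have hcol : M.coloops = ∅ := S2.coloops_eq_empty_of_forall_not M hK
  have hm : n ≤ (M.E \ M.coloops).ncard := by rw [hcol, Set.sdiff_empty, hn]
  have h := ncard_fourCircuits_sub_div_le_of_nonColoops_spread M hfree hns (d := 5) (by rw [hd]; norm_num) (by omega) hm
    (B := 24) (fun M' _ hfree' hns' hd'' => ncard_fourCircuits_le_twenty_four_spread M' hfree' hns' (by rw [hd'']; norm_num))
  exact le_mul_div_of_sub_div_le hn4 h

/-- **The spread `s₄` cap at nullity `7` on `n` points, coloop-free**: `s₄ ≤ ⌊n·33/(n − 4)⌋` (`s − ⌊4s/n⌋ ≤ 33`). -/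
theorem ncard_fourCircuits_le_mul_div_spread_seven (M : Matroid α) [M.Finite]
    (hfree : ∀ e ∈ M.E, ∃ A ⊆ M.E \ {e}, e ∉ M.closure A ∧ e ∉ M.closure ((M.E \ {e}) \ A))
    (hns : ¬ ∃ W ⊆ M.E, W.ncard ≤ 9 ∧ W.encard = M.eRk W + 4) (hd : M.E.encard = M.eRank + 7)
    {n : ℕ} (hn : M.E.ncard = n) (hn4 : 4 < n) (hK : ∀ e, ¬ M.IsColoop e) :
    {C : Set α | M.IsCircuit C ∧ C.ncard = 4}.ncard ≤ n * 33 / (n - 4) := by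
  have hcol : M.coloops = ∅ := S2.coloops_eq_empty_of_forall_not M hK
  have hm : n ≤ (M.E \ M.coloops).ncard := by rw [hcol, Set.sdiff_empty, hn]
  have h := ncard_fourCircuits_sub_div_le_of_nonColoops_spread M hfree hns (d := 6) (by rw [hd]; norm_num) (by omega) hm
    (B := 33) (fun M' _ hfree' hns' hd'' => ncard_fourCircuits_le_thirty_three_spread M' hfree' hns' (by rw [hd'']; norm_num))
  exact le_mul_div_of_sub_div_le hn4 h

/-- **THE `(13, 6)` SPREAD CAP: `s₄ ≤ 30`** on a spread coloop-free e-free core of nullity `6` on `19` points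
(`⌊19·24/15⌋ = 30`; the global cap of `caps_thirteen_six_cf` is `35`). -/
theorem ncard_fourCircuits_le_thirty_spread_nineteen (M : Matroid α) [M.Finite]
    (hfree : ∀ e ∈ M.E, ∃ A ⊆ M.E \ {e}, e ∉ M.closure A ∧ e ∉ M.closure ((M.E \ {e}) \ A))
    (hns : ¬ ∃ W ⊆ M.E, W.ncard ≤ 9 ∧ W.encard = M.eRk W + 4) (hd : M.E.encard = M.eRank + 6)
    (hn : M.E.ncard = 19) (hK : ∀ e, ¬ M.IsColoop e) :
    {C : Set α | M.IsCircuit C ∧ C.ncard = 4}.ncard ≤ 30 := by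
  have h := ncard_fourCircuits_le_mul_div_spread_six M hfree hns hd hn (by norm_num) hK
  norm_num at h
  exact h

/-- **THE `(12, 6)` SPREAD CAP: `s₄ ≤ 30`** on `18` points (`⌊18·24/14⌋ = 30`). -/
theorem ncard_fourCircuits_le_thirty_spread_eighteen (M : Matroid α) [M.Finite]
    (hfree : ∀ e ∈ M.E, ∃ A ⊆ M.E \ {e}, e ∉ M.closure A ∧ e ∉ M.closure ((M.E \ {e}) \ A))
    (hns : ¬ ∃ W ⊆ M.E, W.ncard ≤ 9 ∧ W.encard = M.eRk W + 4) (hd : M.E.encard = M.eRank + 6)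
    (hn : M.E.ncard = 18) (hK : ∀ e, ¬ M.IsColoop e) :
    {C : Set α | M.IsCircuit C ∧ C.ncard = 4}.ncard ≤ 30 := by
  have h := ncard_fourCircuits_le_mul_div_spread_six M hfree hns hd hn (by norm_num) hK
  norm_num at h
  exact h

/-- **THE `(13, 7)` SPREAD CAP: `s₄ ≤ 41`** on `20` points at nullity `7` (`⌊20·33/16⌋ = 41`; the global cap is `56`). -/
theorem ncard_fourCircuits_le_forty_one_spread_twenty (M : Matroid α) [M.Finite]
    (hfree : ∀ e ∈ M.E, ∃ A ⊆ M.E \ {e}, e ∉ M.closure A ∧ e ∉ M.closure ((M.E \ {e}) \ A))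
    (hns : ¬ ∃ W ⊆ M.E, W.ncard ≤ 9 ∧ W.encard = M.eRk W + 4) (hd : M.E.encard = M.eRank + 7)
    (hn : M.E.ncard = 20) (hK : ∀ e, ¬ M.IsColoop e) :
    {C : Set α | M.IsCircuit C ∧ C.ncard = 4}.ncard ≤ 41 := by
  have h := ncard_fourCircuits_le_mul_div_spread_seven M hfree hns hd hn (by norm_num) hK
  norm_num at h
  exact h

end S1

end PercRepro
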